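import Summits.AtomisticToContinuum.FouriersLaw.Theses.OddSectorIrreversibility

/-!
# Restatement package for crux `ClosedConeSensitivity` (E3, stmt-AtomisticToContinuum-14059) — line-lead verdict `misstated`

Definitions only (no theorem, no sorry). This is the consensus SUCCESSOR of the typed E3, assembled in one
elaborating file for the tenure planner's `route edit`, with the one typing fix the triage found
(TRIAGE-r1-2 Appendix A). Sources: SketchIdeator3.lean (crux-ideate k3: `bathOp`, `resample`, `resampleVar`,
`GaussianIBPProjection`, `BoundaryHermiteRegularity`, `ResampledKickCone`, `RepairedWitnessGlue`),
RepairSketchK2.lean (k2: `TapDecoupling` hypotheses), TRIAGE-r1-1 §gaussian-ibp, TRIAGE-r1-2 §2.5/§4/App. A.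
See MISSTATED.md (this seat) for why the typed decl is the wrong item.

* `GaussianIBPProjection'` — k3's clause (1)+(2) with the FIX: `MemLp (partialP b f) 2 μT`,
  `MemLp g 2 μT`, `MemLp (partialP b g) 2 μT`, `MemLp (bathOp T b f) 2 μT` replace the product
  integrabilities (k3's clause (1) is false as typed: `f = ∫₀^{p_b} e^{u²/2T} du` has `bathOp f ≡ 0`
  and boundary term 1). These are the hypotheses of the tree's `integral_mul_sq_sub_gibbsMeasure`.
* `BoundaryHermiteRegularity` — verbatim (support H1; harmonic-automatic with `C = 2/γ`).
* `ResampledKickCone` — verbatim but with the tail exponent FIXED OUTSIDE the `∃ a C` (the planner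
  picks `m`; `m = 3` suffices for the glue, `m = 4` if H1 degrades to k2's `TapCurvatureBudget`), so that
  `a` visibly does not depend on a running `m`.
* `RepairedWitnessGlue'` — the glue shape over the restated pair.
-/

noncomputable section

open MeasureTheory Filter Set
open scoped BigOperators NNReal ENNReal

namespace Summit.AtomisticToContinuum.FouriersLaw.Cruxes.ClosedConeSensitivity.Restatement

open Literature.MathematicalPhysics.KineticTheory.HeatConduction
open Summit.AtomisticToContinuum.FouriersLaw.Theses.OddSectorIrreversibility

variable {N : ℕ}

/-- The Ornstein–Uhlenbeck (bath) operator at site `b`: `𝒩_b f = −T ∂²_{p_b} f + p_b ∂_{p_b} f`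
(the Langevin bath term of `OscillatorChain.generator` is `S_b = −γ 𝒩_b`). -/
def bathOp (T : ℝ) (b : Fin N) (f : PhaseSpace N → ℝ) (x : PhaseSpace N) : ℝ :=
  -(T * partialP b (partialP b f) x) + x.2 b * partialP b f x

/-- Resampling projection `Π_b g (x) = ∫ g(q, p[b ↦ p']) dN(0,T)(p')`. -/
def resample (T : ℝ≥0) (b : Fin N) (g : PhaseSpace N → ℝ) (x : PhaseSpace N) : ℝ :=
  ∫ p', g (x.1, Function.update x.2 b p') ∂(ProbabilityTheory.gaussianReal 0 T)

/-- Mean-square resampled-kick difference `½ ∫ (g(q,p[b↦p']) − g(q,p))² dN(0,T)(p')`. -/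
def resampleVar (T : ℝ≥0) (b : Fin N) (g : PhaseSpace N → ℝ) (x : PhaseSpace N) : ℝ :=
  (1 / 2) * ∫ p', (g (x.1, Function.update x.2 b p') - g x) ^ 2 ∂(ProbabilityTheory.gaussianReal 0 T)

/-- **Fixed-N Gaussian integration by parts with resampling projection (corrected hypotheses).**
Under `μ_T = e^{−H_N/T} dq dp` (Gaussian `N(0,T)` in each momentum): for `f ∈ C²`, `g ∈ C¹` with
`∂_b f, 𝒩_b f, g, ∂_b g ∈ L²(μ_T)`,
(1) `T ∫ ∂_{p_b}f ∂_{p_b}g dμ_T = ∫ (𝒩_b f)(g − Π_b g) dμ_T`; (2) `∫ (g − Π_b g)² dμ_T = ∫ resampleVar g dμ_T`. -/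
def GaussianIBPProjection' : Prop :=
  ∀ ω₂ lam β γ : ℝ, 0 < ω₂ → 0 < lam → 0 < β → 0 < γ → ∀ T : ℝ≥0, 0 < (T : ℝ) →
    ∀ (N : ℕ) (b : Fin N) (f g : PhaseSpace N → ℝ),
      let P := pinnedChain ω₂ lam β γ
      let μT : Measure (PhaseSpace N) :=
        volume.withDensity (fun x : PhaseSpace N => ENNReal.ofReal (Real.exp (-(P.hamiltonian N x) / T)))
      ContDiff ℝ 2 f → ContDiff ℝ 1 g →
      MemLp (partialP b f) 2 μT → MemLp (bathOp T b f) 2 μT →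
      MemLp g 2 μT → MemLp (partialP b g) 2 μT →
        (T : ℝ) * ∫ x, partialP b f x * partialP b g x ∂μT
            = ∫ x, bathOp T b f x * (g x - resample T b g x) ∂μT ∧
        ∫ x, (g x - resample T b g x) ^ 2 ∂μT = ∫ x, resampleVar T b g x ∂μT

/-- **Support H1 (`BoundaryHermiteRegularity`)**, verbatim from SketchIdeator3.lean: for the open
equilibrium corrector `u` (a.e. limit of the finite-horizon Kubo correctors) and its even part
`u⁺ = (u + u∘Θ)/2`, `∫ (𝒩_b u⁺)² dμ_T ≤ C (∫ u·J dμ_T + Z)` uniformly in `N`, at each contact. -/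
def BoundaryHermiteRegularity : Prop :=
  ∀ ω₂ lam β γ : ℝ, 0 < ω₂ → 0 < lam → 0 < β → 0 < γ → ∀ T : ℝ, 0 < T → ∃ C : ℝ,
    ∀ (N : ℕ) (b : Fin N) (u : PhaseSpace N → ℝ), (b.val = 0 ∨ b.val = N - 1) →
      let P := pinnedChain ω₂ lam β γ
      let μT : Measure (PhaseSpace N) :=
        volume.withDensity (fun x : PhaseSpace N => ENNReal.ofReal (Real.exp (-(P.hamiltonian N x) / T)))
      let J : PhaseSpace N → ℝ := fun z => ∑ i : Fin N, P.bondCurrent N i z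
      let ue : PhaseSpace N → ℝ := fun x => (u x + u (x.1, -x.2)) / 2
      ContDiff ℝ 2 u →
      (∀ᵐ x ∂μT, Tendsto (fun τ : ℝ => ∫ t in Set.Ioc (0 : ℝ) τ,
          (∫ y, J y ∂(P.transitionKernel N T T t.toNNReal x))) atTop (nhds (u x))) →
        ∫ x, (bathOp T b ue x) ^ 2 ∂μT ≤ C * ((∫ x, u x * J x ∂μT) + ∫ x, Real.exp (-(P.hamiltonian N x) / T) ∂volume)

/-- **Restated crux C′ (`ResampledKickCone m`)**: mean-square locality of the CLOSED flow under a
THERMAL RESAMPLING of the contact momentum, linear window `t ≤ a·d`, polynomial tail of FIXED order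
`m` (the planner instantiates `m`; `3` suffices for `RepairedWitnessGlue'`):
`∫ resampleVar_T(j_i∘Φ_t) dμ_T ≤ C (1 + (d − t/a))^{−m} Z_N`, uniformly in `N`, bond, contact. No `s²`,
no `s → 0`: capped differences, immune to source amplifiers; its enemies are ballistic energy lumps and
receiver breathers (why-might-fail), hence no exponential tail and ρ = β/lam-dependent constants. -/
def ResampledKickCone (m : ℝ) : Prop :=
  ∀ ω₂ lam β γ : ℝ, 0 < ω₂ → 0 < lam → 0 < β → 0 < γ → ∀ T : ℝ≥0, 0 < (T : ℝ) →
    ∃ a C : ℝ, 0 < a ∧ ∀ (N : ℕ) (i b : Fin N) (t : ℝ), (b.val = 0 ∨ b.val = N - 1) → 0 ≤ t →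
      let P := pinnedChain ω₂ lam β γ
      let P₀ := pinnedChain ω₂ lam β 0
      let μT : Measure (PhaseSpace N) :=
        volume.withDensity (fun x : PhaseSpace N => ENNReal.ofReal (Real.exp (-(P.hamiltonian N x) / T)))
      let d : ℕ := (if b.val = 0 then i.val else N - 2 - i.val)
      let jt : PhaseSpace N → ℝ := fun x => ∫ y, P.bondCurrent N i y ∂(P₀.transitionKernel N T T t.toNNReal x)
      t ≤ a * (d : ℝ) →
        ∫ x, resampleVar T b jt x ∂μT ≤ C * (1 + ((d : ℝ) - t / a)) ^ (-m) * ∫ x, Real.exp (-(P.hamiltonian N x) / T) ∂volume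

/-- Shape of the repaired glue over the restated pair (replaces `ClosedConeSensitivity` in `closes`):
the leak `γT Σ_b ⟨∂_{p_b}u⁺, ∂_{p_b}(j_i∘Φ_t)⟩` is bounded through `GaussianIBPProjection'` by
`γ Σ_b ‖𝒩_b u⁺‖ · ‖(I − Π_b)(j_i∘Φ_t)‖`, i.e. by `BoundaryHermiteRegularity × ResampledKickCone 3`. -/
def RepairedWitnessGlue' : Prop :=
  GaussianIBPProjection' → CorrectorTheory → BoundaryHermiteRegularity → ResampledKickCone 3 →
    ConeScaleCorrector → SubBallisticWindow → GibbsSteadyState → NessUnique → BoundedResponse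

end Summit.AtomisticToContinuum.FouriersLaw.Cruxes.ClosedConeSensitivity.Restatement

end
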